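import Summits.MatrixMultiplication.OmegaCensus.STPP122RankThreeReflectB
import Summits.MatrixMultiplication.OmegaCensus.STPP122RankThreeCertCoverB

/-!
# (1,2,2)³ in (ℤ/3)³ — the RANK-3 ROOM CERTIFICATE, part B — reflection 3/3 and THE RANK-3 ROOM THEOREM

Cell `pub-omega` (unit `pub-omega-stpp-1-g34`), topic `Summits/MatrixMultiplication/OmegaCensus`.
HONEST FRAMING (verbatim): lottery ticket; floor = certified bounds/negative ranges. Census STRUCTURE bookkeeping (C10 / X-38: the identified
MECHANISM at the cell (3, 27)); nothing here is a bound on `ω`.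

REFLECTION, file 3/3 + THE THEOREM: extraction from the covering check (`cover_extract`), the six generators of the stabiliser of block 0 as STPP
symmetries of the tree (`IsSTPP.map_addEquiv`, `IsSTPP.shiftBC`, `isSTPP_roles_ACB`) whose actions on codes are the engine's `genB`/`genC`
(`enc_tau1` … `enc_swapL`, kernel checks), one generator / one word carries a normal-form family to a normal-form family with the same
`#diffSet` and the transformed code quadruple (`gen_step`, `word_step`), and the assembly `rank3_room_of_decisions`; with the kernel decisions
`main_all` (`STPP122RankThreeCertEngine`) and `cover_all` (`STPP122RankThreeCertCoverB`) this gives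
**`rank3_room`: every `(1,2,2)³` STPP family `(A, B, C)` of `ℤ/3 × ℤ/3 × ℤ/3` has `#((⋃ᵢ(Bᵢ − Aᵢ)) − (⋃ᵢ(Cᵢ − Aᵢ))) ≥ 24`** — the MECHANISM behind
`T2(𝔽₃³) = 3` (a fourth triple would need 4 fresh points of the 27 for its own differences: `no_fourth_block`).

References: H. Cohn, R. Kleinberg, B. Szegedy, C. Umans, FOCS 2005 (arXiv:math/0511460), Def. 5.1. Records: HOME `pub-omega-stpp-1-g34/code/rank3/`.
-/

namespace Summit.MatrixMultiplication.OmegaCensus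

namespace Rank3Cert

open Finset Pointwise Literature.Computability.AlgebraicComplexity GLNF STPP211Neg

attribute [local irreducible] E3 g3

variable {B C : Fin 3 → Finset (V 3)} {β₁ β₂ γ₁ γ₂ δ₁ δ₂ ε₁ ε₂ : V 3}

/-! ### Extraction from the covering check -/

/-- `cd` produces codes. -/
theorem cd_lt (x₁ x₂ x₃ : ℕ) : cd x₁ x₂ x₃ < 27 := by
  show Nat.add (Nat.add (Nat.mul (Nat.mod x₁ 3) 9) (Nat.mul (Nat.mod x₂ 3) 3)) (Nat.mod x₃ 3) < 27
  rw [add_eq', add_eq', mul_eq', mul_eq', mod_eq', mod_eq', mod_eq']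
  have h1 := Nat.mod_lt x₁ (by norm_num : 0 < 3)
  have h2 := Nat.mod_lt x₂ (by norm_num : 0 < 3)
  have h3 := Nat.mod_lt x₃ (by norm_num : 0 < 3)
  omega

/-- `genB` produces codes. -/
theorem genB_lt (i v : ℕ) : genB i v < 27 := by
  unfold genB; split_ifs <;> exact cd_lt _ _ _

/-- `genC` produces codes. -/
theorem genC_lt (i v : ℕ) : genC i v < 27 := by
  unfold genC; split_ifs <;> exact cd_lt _ _ _

/-- Components of `srt a b` are `a` and `b`. -/
theorem srt_fst_snd (a b : ℕ) : (srt a b = (a, b)) ∨ (srt a b = (b, a)) := by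
  unfold srt; split_ifs
  · exact Or.inl rfl
  · exact Or.inr rfl

/-- `applyGen` produces codes. -/
theorem applyGen_small (i : ℕ) (x : ℕ × ℕ × ℕ × ℕ) : ((applyGen i x).1 < 27 ∧ (applyGen i x).2.1 < 27 ∧ (applyGen i x).2.2.1 < 27 ∧ (applyGen i x).2.2.2 < 27) := by
  unfold applyGen
  split_ifs with h
  · rcases srt_fst_snd (genB 5 x.2.2.1) (genB 5 x.2.2.2) with e | e <;>
      rcases srt_fst_snd (genC 5 x.1) (genC 5 x.2.1) with f | f <;>
      simp only [e, f] <;> exact ⟨genB_lt _ _, genB_lt _ _, genC_lt _ _, genC_lt _ _⟩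
  · rcases srt_fst_snd (genB i x.1) (genB i x.2.1) with e | e <;>
      rcases srt_fst_snd (genC i x.2.2.1) (genC i x.2.2.2) with f | f <;>
      simp only [e, f] <;> exact ⟨genB_lt _ _, genB_lt _ _, genC_lt _ _, genC_lt _ _⟩

/-- `applyWord` preserves smallness. -/
theorem applyWord_small : ∀ (w : List ℕ) (x : ℕ × ℕ × ℕ × ℕ), ((x).1 < 27 ∧ (x).2.1 < 27 ∧ (x).2.2.1 < 27 ∧ (x).2.2.2 < 27) →
    ((applyWord w x).1 < 27 ∧ (applyWord w x).2.1 < 27 ∧ (applyWord w x).2.2.1 < 27 ∧ (applyWord w x).2.2.2 < 27)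
  | [], x, hx => hx
  | i :: w, x, _ => by
      exact applyWord_small w (applyGen i x) (applyGen_small i x)

/-- `qidx` is injective on small quadruples. -/
theorem qidx_inj {x y : ℕ × ℕ × ℕ × ℕ} (hx : ((x).1 < 27 ∧ (x).2.1 < 27 ∧ (x).2.2.1 < 27 ∧ (x).2.2.2 < 27))
    (hy : ((y).1 < 27 ∧ (y).2.1 < 27 ∧ (y).2.2.1 < 27 ∧ (y).2.2.2 < 27)) (h : qidx x = qidx y) : x = y := by
  obtain ⟨x1, x2, x3, x4⟩ := x
  obtain ⟨y1, y2, y3, y4⟩ := y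
  dsimp only at hx hy
  simp only [qidx, add_eq', mul_eq'] at h
  obtain ⟨h1, h2, h3, h4⟩ := hx
  obtain ⟨g1, g2, g3', g4⟩ := hy
  have e4 : x4 = y4 := by omega
  have e3 : x3 = y3 := by omega
  have e2 : x2 = y2 := by omega
  have e1 : x1 = y1 := by omega
  subst e1 e2 e3 e4; rfl

set_option maxRecDepth 8000 in
/-- The representatives are small. -/
theorem reps_small : ∀ r ∈ reps, ((r).1 < 27 ∧ (r).2.1 < 27 ∧ (r).2.2.1 < 27 ∧ (r).2.2.2 < 27) := by
  decide

/-- **From the covering check:** a small sorted quadruple passing `twoOK` is carried onto a representative by a listed word. -/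
theorem cover_extract (hcov : coverOK g3 = true) {x : ℕ × ℕ × ℕ × ℕ} (hx : ((x).1 < 27 ∧ (x).2.1 < 27 ∧ (x).2.2.1 < 27 ∧ (x).2.2.2 < 27)) (h12 : x.1 < x.2.1) (h34 : x.2.2.1 < x.2.2.2)
    (htwo : twoOK g3 x.1 x.2.1 x.2.2.1 x.2.2.2 = true) : ∃ w ∈ words, applyWord w x ∈ reps := by
  obtain ⟨x1, x2, x3, x4⟩ := x
  obtain ⟨hx1, hx2, hx3, hx4⟩ := hx
  dsimp only at h12 h34 htwo hx1 hx2 hx3 hx4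
  have mem : ∀ {n}, n < 27 → n ∈ codes := fun hn => List.mem_range.2 hn
  have hb1 : Nat.blt x1 x2 = true := by rw [Nat.blt_eq]; exact h12
  have hb2 : Nat.blt x3 x4 = true := by rw [Nat.blt_eq]; exact h34
  simp only [coverOK, List.all_eq_true] at hcov
  have h1 := hcov x1 (mem hx1)
  simp only [coverB, List.all_eq_true] at h1
  have h2 := h1 x2 (mem hx2)
  simp only [hb1, Bool.not_true, Bool.false_or, List.all_eq_true] at h2
  have h4 := h2 x3 (mem hx3) x4 (mem hx4)
  simp only [hb2, htwo, Bool.not_true, Bool.false_or, List.any_eq_true] at h4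
  obtain ⟨w, hw, hbit⟩ := h4
  refine ⟨w, hw, ?_⟩
  rw [show repMask = maskOf (reps.map qidx) from rfl, ← mem_iff_maskOf, List.mem_map] at hbit
  obtain ⟨r, hr, hq⟩ := hbit
  have hsmall := applyWord_small w (x1, x2, x3, x4) ⟨hx1, hx2, hx3, hx4⟩
  rw [← qidx_inj (reps_small r hr) hsmall hq]
  exact hr


/-! ### The six generators as STPP symmetries -/

/-- An additive automorphism of `V 3` from a map, an inverse and pointwise-checked identities. -/
def mkEquiv (f g : V 3 → V 3) (h₁ : ∀ x, g (f x) = x) (h₂ : ∀ x, f (g x) = x) (h₃ : ∀ x y, f (x + y) = f x + f y) : V 3 ≃+ V 3 :=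
  { toFun := f, invFun := g, left_inv := h₁, right_inv := h₂, map_add' := h₃ }

/-- `τ₁ : e₃ ↦ e₃ + e₁`. -/
def tau1 : V 3 ≃+ V 3 := mkEquiv (fun x => (x.1, x.2.1, x.2.2 + x.1)) (fun x => (x.1, x.2.1, x.2.2 - x.1)) (by decide) (by decide) (by decide)
/-- `τ₂ : e₃ ↦ e₃ + e₂`. -/
def tau2 : V 3 ≃+ V 3 := mkEquiv (fun x => (x.1, x.2.1 + x.1, x.2.2)) (fun x => (x.1, x.2.1 - x.1, x.2.2)) (by decide) (by decide) (by decide)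
/-- `ν₃ : e₃ ↦ −e₃`. -/
def nu3 : V 3 ≃+ V 3 := mkEquiv (fun x => (-x.1, x.2.1, x.2.2)) (fun x => (-x.1, x.2.1, x.2.2)) (by decide) (by decide) (by decide)
/-- `ν₁ : e₁ ↦ −e₁`. -/
def nu1 : V 3 ≃+ V 3 := mkEquiv (fun x => (x.1, x.2.1, -x.2.2)) (fun x => (x.1, x.2.1, -x.2.2)) (by decide) (by decide) (by decide)
/-- `ν₂ : e₂ ↦ −e₂`. -/
def nu2 : V 3 ≃+ V 3 := mkEquiv (fun x => (x.1, -x.2.1, x.2.2)) (fun x => (x.1, -x.2.1, x.2.2)) (by decide) (by decide) (by decide)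
/-- `L` : the swap of the `e₁`, `e₂` coordinates. -/
def swapL : V 3 ≃+ V 3 := mkEquiv (fun x => (x.1, x.2.2, x.2.1)) (fun x => (x.1, x.2.2, x.2.1)) (by decide) (by decide) (by decide)

/-- `τ₁` acts on codes by `genB 0 = genC 0` (kernel check over the 27 elements). -/ theorem enc_tau1 : ∀ v : V 3, E3.enc (tau1 v) = genB 0 (E3.enc v) ∧ E3.enc (tau1 v) = genC 0 (E3.enc v) := by decide +kernel
/-- `τ₂` acts on codes by `genB 1 = genC 1`. -/ theorem enc_tau2 : ∀ v : V 3, E3.enc (tau2 v) = genB 1 (E3.enc v) ∧ E3.enc (tau2 v) = genC 1 (E3.enc v) := by decide +kernel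
/-- `ν₃` acts on codes by `genB 2 = genC 2`. -/ theorem enc_nu3 : ∀ v : V 3, E3.enc (nu3 v) = genB 2 (E3.enc v) ∧ E3.enc (nu3 v) = genC 2 (E3.enc v) := by decide +kernel
/-- `ν₁` (+ `e₁` on the `B` side) acts on codes by `genB 3` / `genC 3`. -/ theorem enc_nu1 : ∀ v : V 3, E3.enc (nu1 v + e1) = genB 3 (E3.enc v) ∧ E3.enc (nu1 v) = genC 3 (E3.enc v) := by decide +kernel
/-- `ν₂` (+ `e₂` on the `C` side) acts on codes by `genB 4` / `genC 4`. -/ theorem enc_nu2 : ∀ v : V 3, E3.enc (nu2 v) = genB 4 (E3.enc v) ∧ E3.enc (nu2 v + e2) = genC 4 (E3.enc v) := by decide +kernel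
/-- `L` acts on codes by `genB 5 = genC 5`. -/ theorem enc_swapL : ∀ v : V 3, E3.enc (swapL v) = genB 5 (E3.enc v) ∧ E3.enc (swapL v) = genC 5 (E3.enc v) := by decide +kernel

/-- Frame value. -/ theorem tau1_zero : tau1 (0 : V 3) = 0 := by decide
/-- Frame value. -/ theorem tau1_e1 : tau1 (e1 : V 3) = e1 := by decide
/-- Frame value. -/ theorem tau1_e2 : tau1 (e2 : V 3) = e2 := by decide
/-- Frame value. -/ theorem tau2_zero : tau2 (0 : V 3) = 0 := by decide
/-- Frame value. -/ theorem tau2_e1 : tau2 (e1 : V 3) = e1 := by decide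
/-- Frame value. -/ theorem tau2_e2 : tau2 (e2 : V 3) = e2 := by decide
/-- Frame value. -/ theorem nu3_zero : nu3 (0 : V 3) = 0 := by decide
/-- Frame value. -/ theorem nu3_e1 : nu3 (e1 : V 3) = e1 := by decide
/-- Frame value. -/ theorem nu3_e2 : nu3 (e2 : V 3) = e2 := by decide
/-- Frame value. -/ theorem nu1_zero : nu1 (0 : V 3) = 0 := by decide
/-- Frame value. -/ theorem nu1_e1_add : nu1 (e1 : V 3) + e1 = 0 := by decide
/-- Frame value. -/ theorem nu1_e2 : nu1 (e2 : V 3) = e2 := by decide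
/-- Frame value. -/ theorem nu2_zero : nu2 (0 : V 3) = 0 := by decide
/-- Frame value. -/ theorem nu2_e1 : nu2 (e1 : V 3) = e1 := by decide
/-- Frame value. -/ theorem nu2_e2_add : nu2 (e2 : V 3) + e2 = 0 := by decide
/-- Frame value. -/ theorem swapL_zero : swapL (0 : V 3) = 0 := by decide
/-- Frame value. -/ theorem swapL_e1 : swapL (e1 : V 3) = e2 := by decide
/-- Frame value. -/ theorem swapL_e2 : swapL (e2 : V 3) = e1 := by decide

/-- `genC 5 = genB 5` (both are the coordinate swap). -/
theorem genC_five (v : ℕ) : genC 5 v = genB 5 v := by simp [genB, genC]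

/-- `Nat.ble` on a strict inequality. -/
theorem ble_of_lt {m n : ℕ} (h : m < n) : Nat.ble m n = true ∧ Nat.ble n m = false := by
  constructor
  · rw [Nat.ble_eq]; exact le_of_lt h
  · cases hq : Nat.ble n m
    · rfl
    · rw [Nat.ble_eq] at hq; omega

/-- `srt` is symmetric. -/
theorem srt_comm (a b : ℕ) : srt a b = srt b a := by
  unfold srt
  rcases Nat.lt_trichotomy a b with h | h | h
  · rw [(ble_of_lt h).1, (ble_of_lt h).2]; rfl
  · subst h; rfl
  · rw [(ble_of_lt h).1, (ble_of_lt h).2]; rfl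

/-- The code quadruple of a block `({β₁,β₂},{γ₁,γ₂})` (sorted codes). -/
noncomputable def cq (β₁ β₂ γ₁ γ₂ : V 3) : ℕ × ℕ × ℕ × ℕ :=
  ((srt (E3.enc β₁) (E3.enc β₂)).1, (srt (E3.enc β₁) (E3.enc β₂)).2, (srt (E3.enc γ₁) (E3.enc γ₂)).1, (srt (E3.enc γ₁) (E3.enc γ₂)).2)

/-- `srt` commutes with a map applied to both arguments of a sorted pair. -/
theorem srt_map (f : ℕ → ℕ) (a b : ℕ) : srt (f (srt a b).1) (f (srt a b).2) = srt (f a) (f b) := by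
  rcases srt_fst_snd a b with e | e <;> rw [e]
  exact srt_comm _ _


/-! ### One generator step on a normal-form family -/

/-- The shape of a normal-form family with named block-1 elements (spelled out; no predicate is introduced):
`IsSTPP`, cards, block 0 = `({0},{0,e₁},{0,e₂})`, block 1 = `({0},{β₁,β₂},{γ₁,γ₂})`, difference-set size `D`, code quadruple `x`. -/
theorem step_affine (φ : V 3 ≃+ V 3) (β γ : V 3) (fB fC : ℕ → ℕ)
    (hfB : ∀ v, E3.enc (φ v + β) = fB (E3.enc v)) (hfC : ∀ v, E3.enc (φ v + γ) = fC (E3.enc v))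
    (h0 : ({φ 0 + β, φ e1 + β} : Finset (V 3)) = {0, e1}) (h0' : ({φ 0 + γ, φ e2 + γ} : Finset (V 3)) = {0, e2})
    {B C : Fin 3 → Finset (V 3)} {β₁ β₂ γ₁ γ₂ : V 3} {D : ℕ}
    (hS : IsSTPP (fun _ : Fin 3 => ({0} : Finset (V 3))) B C) (hc : ∀ i, (B i).card = 2 ∧ (C i).card = 2)
    (hB0 : B 0 = {0, e1}) (hC0 : C 0 = {0, e2}) (hB1 : B 1 = {β₁, β₂}) (hC1 : C 1 = {γ₁, γ₂})
    (hD : (diffSet (fun _ : Fin 3 => ({0} : Finset (V 3))) B C).card = D) :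
    ∃ (B' C' : Fin 3 → Finset (V 3)) (β₁' β₂' γ₁' γ₂' : V 3),
      IsSTPP (fun _ : Fin 3 => ({0} : Finset (V 3))) B' C' ∧ (∀ i, (B' i).card = 2 ∧ (C' i).card = 2) ∧
      B' 0 = {0, e1} ∧ C' 0 = {0, e2} ∧ B' 1 = {β₁', β₂'} ∧ C' 1 = {γ₁', γ₂'} ∧
      (diffSet (fun _ : Fin 3 => ({0} : Finset (V 3))) B' C').card = D ∧
      cq β₁' β₂' γ₁' γ₂' = ((srt (fB (cq β₁ β₂ γ₁ γ₂).1) (fB (cq β₁ β₂ γ₁ γ₂).2.1)).1, (srt (fB (cq β₁ β₂ γ₁ γ₂).1) (fB (cq β₁ β₂ γ₁ γ₂).2.1)).2,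
        (srt (fC (cq β₁ β₂ γ₁ γ₂).2.2.1) (fC (cq β₁ β₂ γ₁ γ₂).2.2.2)).1, (srt (fC (cq β₁ β₂ γ₁ γ₂).2.2.1) (fC (cq β₁ β₂ γ₁ γ₂).2.2.2)).2) := by
  classical
  have hA : (fun _ : Fin 3 => (({0} : Finset (V 3)).image φ)) = fun _ => ({0} : Finset (V 3)) := by
    funext i; rw [image_singleton, map_zero]
  have hS' := (hS.map_addEquiv φ).shiftBC β γ
  rw [hA] at hS'
  refine ⟨fun i => ((B i).image φ).image (· + β), fun i => ((C i).image φ).image (· + γ),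
    φ β₁ + β, φ β₂ + β, φ γ₁ + γ, φ γ₂ + γ, hS', fun i => ⟨?_, ?_⟩, ?_, ?_, ?_, ?_, ?_, ?_⟩
  · rw [card_image_of_injective _ (add_left_injective _), card_image_of_injective _ φ.injective]; exact (hc i).1
  · rw [card_image_of_injective _ (add_left_injective _), card_image_of_injective _ φ.injective]; exact (hc i).2
  · show ((B 0).image φ).image (· + β) = {0, e1}
    rw [hB0, image_pair, image_pair, h0]
  · show ((C 0).image φ).image (· + γ) = {0, e2}
    rw [hC0, image_pair, image_pair, h0']
  · show ((B 1).image φ).image (· + β) = _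
    rw [hB1, image_pair, image_pair]
  · show ((C 1).image φ).image (· + γ) = _
    rw [hC1, image_pair, image_pair]
  · have h1 := card_diffSet_shiftBC (k := 2) (fun _ => (({0} : Finset (V 3)).image φ)) (fun i => (B i).image φ) (fun i => (C i).image φ) β γ
    have h2 := card_diffSet_map (k := 2) (fun _ : Fin 3 => ({0} : Finset (V 3))) B C φ
    rw [hA] at h1
    rw [h1, ← hD, ← h2, hA]
  · simp only [cq, hfB, hfC, srt_map]

/-- Negation maps a difference set `s − t` onto `t − s`. -/
theorem card_sub_comm (s t : Finset (V 3)) : (s - t).card = (t - s).card := by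
  have key : ∀ s t : Finset (V 3), (t - s).image (fun x => -x) ⊆ s - t := by
    intro s t x hx
    obtain ⟨y, hy, rfl⟩ := mem_image.1 hx
    obtain ⟨a, ha, b, hb, rfl⟩ := mem_sub.1 hy
    exact mem_sub.2 ⟨b, hb, a, ha, by abel⟩
  apply le_antisymm
  · have := card_le_card (key t s)
    rwa [card_image_of_injective _ neg_injective] at this
  · have := card_le_card (key s t)
    rwa [card_image_of_injective _ neg_injective] at this

/-- The swap step: roles `B ↔ C` followed by the coordinate swap `L`. -/
theorem step_swap {B C : Fin 3 → Finset (V 3)} {β₁ β₂ γ₁ γ₂ : V 3} {D : ℕ}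
    (hS : IsSTPP (fun _ : Fin 3 => ({0} : Finset (V 3))) B C) (hc : ∀ i, (B i).card = 2 ∧ (C i).card = 2)
    (hB0 : B 0 = {0, e1}) (hC0 : C 0 = {0, e2}) (hB1 : B 1 = {β₁, β₂}) (hC1 : C 1 = {γ₁, γ₂})
    (hD : (diffSet (fun _ : Fin 3 => ({0} : Finset (V 3))) B C).card = D) :
    ∃ (B' C' : Fin 3 → Finset (V 3)) (β₁' β₂' γ₁' γ₂' : V 3),
      IsSTPP (fun _ : Fin 3 => ({0} : Finset (V 3))) B' C' ∧ (∀ i, (B' i).card = 2 ∧ (C' i).card = 2) ∧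
      B' 0 = {0, e1} ∧ C' 0 = {0, e2} ∧ B' 1 = {β₁', β₂'} ∧ C' 1 = {γ₁', γ₂'} ∧
      (diffSet (fun _ : Fin 3 => ({0} : Finset (V 3))) B' C').card = D ∧
      cq β₁' β₂' γ₁' γ₂' = applyGen 5 (cq β₁ β₂ γ₁ γ₂) := by
  classical
  have hA : (fun _ : Fin 3 => (({0} : Finset (V 3)).image swapL)) = fun _ => ({0} : Finset (V 3)) := by
    funext i; rw [image_singleton, map_zero]
  have hS' := (isSTPP_roles_ACB hS).map_addEquiv swapL
  rw [hA] at hS'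
  refine ⟨fun i => (C i).image swapL, fun i => (B i).image swapL, swapL γ₁, swapL γ₂, swapL β₁, swapL β₂, hS',
    fun i => ⟨?_, ?_⟩, ?_, ?_, ?_, ?_, ?_, ?_⟩
  · rw [card_image_of_injective _ swapL.injective]; exact (hc i).2
  · rw [card_image_of_injective _ swapL.injective]; exact (hc i).1
  · show (C 0).image swapL = {0, e1}
    rw [hC0, image_pair, swapL_zero, swapL_e2]
  · show (B 0).image swapL = {0, e2}
    rw [hB0, image_pair, swapL_zero, swapL_e1]
  · show (C 1).image swapL = _
    rw [hC1, image_pair]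
  · show (B 1).image swapL = _
    rw [hB1, image_pair]
  · have h2 := card_diffSet_map (k := 2) (fun _ : Fin 3 => ({0} : Finset (V 3))) C B swapL
    rw [hA] at h2
    rw [h2, ← hD]
    unfold diffSet
    exact card_sub_comm _ _
  · simp only [cq, applyGen, if_pos, (enc_swapL _).1, genC_five, srt_map]

/-- **One generator (index `≤ 5`) maps a normal-form family to a normal-form family with the same difference-set size and the code
quadruple transformed by `applyGen`.** -/
theorem gen_step {i : ℕ} (hi : i ≤ 5) {D : ℕ} {x : ℕ × ℕ × ℕ × ℕ}
    (h : ∃ (B C : Fin 3 → Finset (V 3)) (β₁ β₂ γ₁ γ₂ : V 3),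
      IsSTPP (fun _ : Fin 3 => ({0} : Finset (V 3))) B C ∧ (∀ i, (B i).card = 2 ∧ (C i).card = 2) ∧
      B 0 = {0, e1} ∧ C 0 = {0, e2} ∧ B 1 = {β₁, β₂} ∧ C 1 = {γ₁, γ₂} ∧
      (diffSet (fun _ : Fin 3 => ({0} : Finset (V 3))) B C).card = D ∧ cq β₁ β₂ γ₁ γ₂ = x) :
    ∃ (B C : Fin 3 → Finset (V 3)) (β₁ β₂ γ₁ γ₂ : V 3),
      IsSTPP (fun _ : Fin 3 => ({0} : Finset (V 3))) B C ∧ (∀ i, (B i).card = 2 ∧ (C i).card = 2) ∧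
      B 0 = {0, e1} ∧ C 0 = {0, e2} ∧ B 1 = {β₁, β₂} ∧ C 1 = {γ₁, γ₂} ∧
      (diffSet (fun _ : Fin 3 => ({0} : Finset (V 3))) B C).card = D ∧ cq β₁ β₂ γ₁ γ₂ = applyGen i x := by
  obtain ⟨B, C, β₁, β₂, γ₁, γ₂, hS, hc, hB0, hC0, hB1, hC1, hD, rfl⟩ := h
  -- the five affine generators
  have aff : ∀ (φ : V 3 ≃+ V 3) (β γ : V 3) (j : ℕ), j ≠ 5 → (∀ v, E3.enc (φ v + β) = genB j (E3.enc v)) →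
      (∀ v, E3.enc (φ v + γ) = genC j (E3.enc v)) →
      ({φ 0 + β, φ e1 + β} : Finset (V 3)) = {0, e1} → ({φ 0 + γ, φ e2 + γ} : Finset (V 3)) = {0, e2} →
      ∃ (B' C' : Fin 3 → Finset (V 3)) (β₁' β₂' γ₁' γ₂' : V 3),
        IsSTPP (fun _ : Fin 3 => ({0} : Finset (V 3))) B' C' ∧ (∀ i, (B' i).card = 2 ∧ (C' i).card = 2) ∧
        B' 0 = {0, e1} ∧ C' 0 = {0, e2} ∧ B' 1 = {β₁', β₂'} ∧ C' 1 = {γ₁', γ₂'} ∧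
        (diffSet (fun _ : Fin 3 => ({0} : Finset (V 3))) B' C').card = D ∧ cq β₁' β₂' γ₁' γ₂' = applyGen j (cq β₁ β₂ γ₁ γ₂) := by
    intro φ β γ j hj hfB hfC h0 h0'
    obtain ⟨B', C', a, b, c, d, h1, h2, h3, h4, h5, h6, h7, h8⟩ := step_affine φ β γ (genB j) (genC j) hfB hfC h0 h0' hS hc hB0 hC0 hB1 hC1 hD
    refine ⟨B', C', a, b, c, d, h1, h2, h3, h4, h5, h6, h7, ?_⟩
    rw [h8]; unfold applyGen; rw [if_neg hj]
  interval_cases i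
  · exact aff tau1 0 0 0 (by decide) (fun v => by rw [add_zero]; exact (enc_tau1 v).1) (fun v => by rw [add_zero]; exact (enc_tau1 v).2)
      (by rw [add_zero, add_zero, tau1_zero, tau1_e1]) (by rw [add_zero, add_zero, tau1_zero, tau1_e2])
  · exact aff tau2 0 0 1 (by decide) (fun v => by rw [add_zero]; exact (enc_tau2 v).1) (fun v => by rw [add_zero]; exact (enc_tau2 v).2)
      (by rw [add_zero, add_zero, tau2_zero, tau2_e1]) (by rw [add_zero, add_zero, tau2_zero, tau2_e2])
  · exact aff nu3 0 0 2 (by decide) (fun v => by rw [add_zero]; exact (enc_nu3 v).1) (fun v => by rw [add_zero]; exact (enc_nu3 v).2)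
      (by rw [add_zero, add_zero, nu3_zero, nu3_e1]) (by rw [add_zero, add_zero, nu3_zero, nu3_e2])
  · exact aff nu1 e1 0 3 (by decide) (fun v => (enc_nu1 v).1) (fun v => by rw [add_zero]; exact (enc_nu1 v).2)
      (by rw [nu1_zero, zero_add, nu1_e1_add, pair_comm]) (by rw [add_zero, add_zero, nu1_zero, nu1_e2])
  · exact aff nu2 0 e2 4 (by decide) (fun v => by rw [add_zero]; exact (enc_nu2 v).1) (fun v => (enc_nu2 v).2)
      (by rw [add_zero, add_zero, nu2_zero, nu2_e1]) (by rw [nu2_zero, zero_add, nu2_e2_add, pair_comm])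
  · exact step_swap hS hc hB0 hC0 hB1 hC1 hD

set_option maxRecDepth 8000 in
/-- The letters of the listed words are generator indices `≤ 5`. -/
theorem words_le : ∀ w ∈ words, ∀ i ∈ w, i ≤ 5 := by decide +kernel

/-- **A word maps a normal-form family to a normal-form family** (same difference-set size, code quadruple transformed by `applyWord`). -/
theorem word_step : ∀ (w : List ℕ), (∀ i ∈ w, i ≤ 5) → ∀ {D : ℕ} {x : ℕ × ℕ × ℕ × ℕ},
    (∃ (B C : Fin 3 → Finset (V 3)) (β₁ β₂ γ₁ γ₂ : V 3),
      IsSTPP (fun _ : Fin 3 => ({0} : Finset (V 3))) B C ∧ (∀ i, (B i).card = 2 ∧ (C i).card = 2) ∧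
      B 0 = {0, e1} ∧ C 0 = {0, e2} ∧ B 1 = {β₁, β₂} ∧ C 1 = {γ₁, γ₂} ∧
      (diffSet (fun _ : Fin 3 => ({0} : Finset (V 3))) B C).card = D ∧ cq β₁ β₂ γ₁ γ₂ = x) →
    ∃ (B C : Fin 3 → Finset (V 3)) (β₁ β₂ γ₁ γ₂ : V 3),
      IsSTPP (fun _ : Fin 3 => ({0} : Finset (V 3))) B C ∧ (∀ i, (B i).card = 2 ∧ (C i).card = 2) ∧
      B 0 = {0, e1} ∧ C 0 = {0, e2} ∧ B 1 = {β₁, β₂} ∧ C 1 = {γ₁, γ₂} ∧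
      (diffSet (fun _ : Fin 3 => ({0} : Finset (V 3))) B C).card = D ∧ cq β₁ β₂ γ₁ γ₂ = applyWord w x
  | [], _, _, _, h => h
  | i :: w, hw, _, _, h =>
      word_step w (fun j hj => hw j (List.mem_cons_of_mem _ hj)) (gen_step (hw i (List.mem_cons_self)) h)


/-! ### Assembly (the two kernel decisions as hypotheses) -/

/-- **THE RANK-3 ROOM MECHANISM, modulo the kernel decisions `main_all` and `cover_all`:** every `(1,2,2)³` STPP family of `(ℤ/3)³`
has a difference set `(⋃ᵢ(Bᵢ − Aᵢ)) − (⋃ᵢ(Cᵢ − Aᵢ))` of at least `24` of the `27` points.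
[cite: CohnKleinbergSzegedyUmans2005, Def. 5.1] -/
theorem rank3_room_of_decisions (hmain : reps.all (repOK g3 3) = true) (hcov : coverOK g3 = true)
    {A B C : Fin 3 → Finset (V 3)} (hS : IsSTPP A B C) (hc : ∀ i, (A i).card = 1 ∧ (B i).card = 2 ∧ (C i).card = 2) :
    24 ≤ (diffSet A B C).card := by
  classical
  obtain ⟨A', B', C', hS', hc', hD', hA', hB0, hC0⟩ := exists_nf122_three (k := 2) hS hc
  have hAe : A' = fun _ => ({0} : Finset (V 3)) := funext hA'
  subst hAe
  obtain ⟨β₁, β₂, hB1, hβlt⟩ := exists_pair_lt (hc' 1).2.1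
  obtain ⟨γ₁, γ₂, hC1, hγlt⟩ := exists_pair_lt (hc' 1).2.2
  have hβ : β₁ ≠ β₂ := fun h => by rw [h] at hβlt; exact lt_irrefl _ hβlt
  have htwo := twoOK_true hS' hB0 hC0 hB1 hC1 hβ
  have hcq : cq β₁ β₂ γ₁ γ₂ = (E3.enc β₁, E3.enc β₂, E3.enc γ₁, E3.enc γ₂) := by
    unfold cq srt; rw [(ble_of_lt hβlt).1, (ble_of_lt hγlt).1]; rfl
  obtain ⟨w, hw, hrep⟩ := cover_extract hcov (x := (E3.enc β₁, E3.enc β₂, E3.enc γ₁, E3.enc γ₂))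
    ⟨enc_lt _, enc_lt _, enc_lt _, enc_lt _⟩ hβlt hγlt htwo
  have hcards : ∀ i, (B' i).card = 2 ∧ (C' i).card = 2 := fun i => ⟨(hc' i).2.1, (hc' i).2.2⟩
  obtain ⟨B'', C'', b1, b2, c1, c2, hS'', hc'', hB0'', hC0'', hB1'', hC1'', hD'', hcq''⟩ :=
    word_step w (words_le w hw) ⟨B', C', β₁, β₂, γ₁, γ₂, hS', hcards, hB0, hC0, hB1, hC1, rfl, hcq⟩
  rw [← hD', ← hD'']
  rw [← hcq''] at hrep
  -- orient the pairs of block 1 of the final family by code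
  rcases srt_fst_snd (E3.enc b1) (E3.enc b2) with e | e <;> rcases srt_fst_snd (E3.enc c1) (E3.enc c2) with f | f
  · have hx : cq b1 b2 c1 c2 = (E3.enc b1, E3.enc b2, E3.enc c1, E3.enc c2) := by unfold cq; rw [e, f]
    rw [hx] at hrep
    exact room_of_rep hmain hS'' hB0'' hC0'' hB1'' hC1'' (hc'' 2).1 (hc'' 2).2 hrep
  · have hx : cq b1 b2 c1 c2 = (E3.enc b1, E3.enc b2, E3.enc c2, E3.enc c1) := by unfold cq; rw [e, f]
    rw [hx] at hrep
    exact room_of_rep hmain hS'' hB0'' hC0'' hB1'' (hC1''.trans (pair_comm _ _)) (hc'' 2).1 (hc'' 2).2 hrep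
  · have hx : cq b1 b2 c1 c2 = (E3.enc b2, E3.enc b1, E3.enc c1, E3.enc c2) := by unfold cq; rw [e, f]
    rw [hx] at hrep
    exact room_of_rep hmain hS'' hB0'' hC0'' (hB1''.trans (pair_comm _ _)) hC1'' (hc'' 2).1 (hc'' 2).2 hrep
  · have hx : cq b1 b2 c1 c2 = (E3.enc b2, E3.enc b1, E3.enc c2, E3.enc c1) := by unfold cq; rw [e, f]
    rw [hx] at hrep
    exact room_of_rep hmain hS'' hB0'' hC0'' (hB1''.trans (pair_comm _ _)) (hC1''.trans (pair_comm _ _)) (hc'' 2).1 (hc'' 2).2 hrep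

/-! ### The theorem -/

/-- **THE RANK-3 ROOM MECHANISM (kernel):** every STPP family of size pattern `(1,2,2)³` in `ℤ/3 × ℤ/3 × ℤ/3` has a difference set
`(⋃ᵢ(Bᵢ − Aᵢ)) − (⋃ᵢ(Cᵢ − Aᵢ))` of at least `24` of the `27` points. (The identified mechanism of the census cell `(k, |G|) = (3, 27)`:
a fourth `(1,2,2)` triple would need its four differences outside this set.) [cite: CohnKleinbergSzegedyUmans2005, Def. 5.1] -/
theorem rank3_room {A B C : Fin 3 → Finset (V 3)} (hS : IsSTPP A B C) (hc : ∀ i, (A i).card = 1 ∧ (B i).card = 2 ∧ (C i).card = 2) :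
    24 ≤ (diffSet A B C).card :=
  rank3_room_of_decisions main_all cover_all hS hc

end Rank3Cert

end Summit.MatrixMultiplication.OmegaCensus
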